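import Literature.MathematicalPhysics.QuantumFieldTheory.Balaban1983to89.B9FromB6

/-!
# `Balaban1983to89.B9FromB6ModelSignsOn` — [Balaban1985BackgroundPropagators] Cor. 3.5 p. 407 (the `U = 1` edge from [4]): the N06 knit's sign schema
# `B9FromB6.ModelSigns` with the Hölder monotonicity `holder_mono` asked ONLY on a sub-family of arguments, and the edge theorem re-run with it
# (knit-side repair R3 of the located hazard «`holder_mono` fails on the site summand of the torus-of-record geometry», dag-n03-b HAZARD-1)

B9 = T. Bałaban, *Propagators for lattice gauge theories in a background field*, Commun. Math. Phys. **99** (1985) 389–434 [Balaban1985BackgroundPropagators];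
[4] = [Balaban1984PropagatorsII].  pub-ymgap Track A, node N06; seat `pub-ymgap-dag-n06-a` g3 (KNIT-BY-NAME ∕ def-Y).  Count-neutral; nothing of print is asserted.

WHY.  The knit (`B9LeafKnit.b9_main_at_run_of_leaves` via `B9FromB6.baseU1_of_B6`) takes `S : ∀ i, B9FromB6.ModelSigns (geo i)`, whose field
`holder_mono : ∀ ε ε′ λ, ε ≤ ε′ → ‖λ‖_ε ≤ ‖λ‖_{ε′}` (the G-B9-13 range repair) ranges over ALL arguments `λ : g.Loc`.  At the Stage-3′(Y) pin the geometry READS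
`Node00.kGeoU i` (dag-n03-b's `B9GeoNormsKLevelV1.geo9K`, p418382), whose argument type is a SUM (torus-site functions ⊕ fine-bond functions) and whose
site-summand Hölder functional is T8's all-pairs quotient `hqTP` — NOT monotone in the exponent (n03-b's tent-function computation, pub-ymgap INBOX
[N03B-G2-HAZARD-1]): `ModelSigns (geo9K i)` is FALSE at `holder_mono`.  But `holder_mono` is USED by the edge proof only in the (3.44)∕(3.45) clauses of
`G(1)`, i.e. for arguments on which the operator family `GA` is read — and NODE 00 reads `G = Δ_a⁻¹` as `0` on the site summand (`Node00.GU.e4 (.inl _) := 0`,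
`GU.h2 (.inl _, _) := 0`).  So the edge needs monotonicity only ON the arguments that `GA`'s (3.44)∕(3.45) quantities actually see.

WHAT IS PROVED (kernel; one hypothesis schema + theorems):
* `ModelSignsOn g P` — `B9FromB6.ModelSigns g` with `holder_mono` restricted to `λ` with `P λ` (OURS, typing); `ModelSignsOn.of_modelSigns` (the old schema is the
  case `P ≡ True` up to weakening), `ModelSignsOn.len_nonneg`.
* **`baseU1_of_B6_on`** — `B9FromB6.baseU1_of_B6` RE-RUN with `S : ∀ i, ModelSignsOn (geo i) (P i)` and the two NULL-READING hypotheses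
  `hE4 : ∀ i λ, ¬ P i λ → ∀ y, (GA i).e4 1 λ y ≤ 0`, `hH2 : ∀ i λ, ¬ P i λ → ∀ β ζ, (GA i).h2 1 λ β ζ ≤ 0`: same conclusion `B9.BaseU1Printed d geo bg Gp GA C`,
  same constants; the proof is the tree's, clause by clause, with a case split `P i λ ∨ ¬ P i λ` in the two Hölder-input clauses of `G(1)`.
* `cor35_of_B6_on` — the composition with `B9.cor35_of_sectB_base` (as `B9FromB6.cor35_of_B6`).
HONEST SCOPE: bookkeeping on hypothesis STRUCTURES of the `U = 1` edge; the clean long-term repair (R1: restate `kGeoU`'s site-summand Hölder functional over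
near pairs `|x − x′| ≤ Lᵏ`, print's (1.109)∕(3.40)) belongs to a `node00-def` successor; nothing continuum ∕ OS ∕ mass gap ∕ Clay.
-/

namespace Literature.MathematicalPhysics.QuantumFieldTheory.Balaban1983to89.B9FromB6ModelSignsOn

open B9FromB6

variable {g : B9.Geometry} {B : B9.Backgrounds}

/-- **Sign and monotonicity facts of the lattice quantities entering (3.42)–(3.47), with the Hölder monotonicity asked only ON a sub-family `P` of arguments**
(all other fields as in `B9FromB6.ModelSigns`).  OURS (typing): a hypothesis schema on how a model instantiates the norms (3.39)–(3.41); nothing asserted.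
[cite: Balaban1985BackgroundPropagators, (3.39)–(3.41) p.397 (the norms; their evident sign facts)] -/
structure ModelSignsOn (g : B9.Geometry) (P : g.Loc → Prop) : Prop where
  L_nonneg : 0 ≤ g.L
  eta_nonneg : 0 ≤ g.eta
  dist_nonneg : ∀ y y' : g.Site, 0 ≤ g.dist y y'
  supNorm_nonneg : ∀ lam : g.Loc, 0 ≤ g.supNorm lam
  l2Norm_nonneg : ∀ lam : g.Loc, 0 ≤ g.l2Norm lam
  wNorm_nonneg : ∀ (γ : ℝ) (lam : g.Loc), 0 ≤ g.wNorm γ lam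
  holder_nonneg : ∀ (ε : ℝ) (lam : g.Loc), 0 ≤ g.holder ε lam
  holder_mono_on : ∀ (ε ε' : ℝ) (lam : g.Loc), P lam → ε ≤ ε' → g.holder ε lam ≤ g.holder ε' lam
  cutH_nonneg : ∀ (β : ℝ) (ζ : g.Cut), 0 ≤ g.cutH β ζ
  cutSup_nonneg : ∀ h : g.Cut, 0 ≤ g.cutSup h

/-- the unrestricted schema gives the restricted one for every `P`. [cite: Balaban1985BackgroundPropagators, (3.39)–(3.41) p.397 (bookkeeping)] -/
theorem ModelSignsOn.of_modelSigns (S : ModelSigns g) (P : g.Loc → Prop) : ModelSignsOn g P :=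
  ⟨S.L_nonneg, S.eta_nonneg, S.dist_nonneg, S.supNorm_nonneg, S.l2Norm_nonneg, S.wNorm_nonneg, S.holder_nonneg,
    fun ε ε' lam _ h => S.holder_mono ε ε' lam h, S.cutH_nonneg, S.cutSup_nonneg⟩

/-- `Lʲη ≥ 0` under the sign facts. [cite: Balaban1985BackgroundPropagators, (3.41) p.397 (bookkeeping)] -/
theorem ModelSignsOn.len_nonneg {P : g.Loc → Prop} (S : ModelSignsOn g P) (y : g.Site) : 0 ≤ g.len y :=
  show 0 ≤ g.L ^ g.scale y * g.eta from mul_nonneg (pow_nonneg S.L_nonneg _) S.eta_nonneg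

/-- **THE INDUCTION BASE OF B9 FROM [4] — `B9FromB6.baseU1_of_B6` with the restricted sign schema.**  Inputs as there: the dictionary `DictAtOne` per member,
[4] Props. 2.2, 2.3, 2.6 for the image families, the residual entries `ResidualGpAtOne`∕`ResidualGAGlobAtOne`; NEW: `S : ∀ i, ModelSignsOn (geo i) (P i)` and
the null readings `hE4`, `hH2` of `G(1)`'s (3.44)∕(3.45) quantities OFF `P i`.  Conclusion and constants identical (`B₀ = max`, `δ₀ = min`, thresholds
merged, `B′₀(ε)` from `C(ε∕2)`, `B′₀(ε, β)` from `C(β, min{ε, (1−β)∕2})`); on `P i` the range repair G-B9-13 is `holder_mono_on`, off `P i` the clause is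
`0 ≤ (nonnegative right-hand side)`. [cite: Balaban1985BackgroundPropagators, Cor. 3.5 proof p.407 («for U = 1 these theorems are proved in [4]»)] -/
theorem baseU1_of_B6_on {I : Type} (d : ℕ) (geo₆ : I → B6.Geometry) (Gp₆ : ∀ i, B6.GpFamily (geo₆ i))
    (C₆ : ∀ i, B6.SiteKernel (geo₆ i)) (G₆ : ∀ i, B6.GFamily (geo₆ i))
    (geo : I → B9.Geometry) (bg : I → B9.Backgrounds) (Gp GA : ∀ i, B9.KernelFamily (geo i) (bg i))
    (C : ∀ i, B9.SiteKernel (geo i) (bg i))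
    (D : ∀ i, DictAtOne (geo₆ i) (geo i) (bg i) (Gp₆ i) (C₆ i) (G₆ i) (Gp i) (GA i) (C i))
    (P : ∀ i, (geo i).Loc → Prop) (S : ∀ i, ModelSignsOn (geo i) (P i))
    (hE4 : ∀ i (lam : (geo i).Loc), ¬ P i lam → ∀ y, (GA i).e4 (bg i).one lam y ≤ 0)
    (hH2 : ∀ i (lam : (geo i).Loc), ¬ P i lam → ∀ (β : ℝ) (ζ : (geo i).Cut), (GA i).h2 (bg i).one lam β ζ ≤ 0)
    (h22 : B6.Prop22Printed geo₆ Gp₆) (h23 : B6.Prop23Printed d geo₆ C₆) (h26 : B6.Prop26Printed geo₆ G₆)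
    (hGp : ResidualGpAtOne geo bg Gp) (hGA : ResidualGAGlobAtOne geo bg GA) :
    B9.BaseU1Printed d geo bg Gp GA C := by
  obtain ⟨M₂₂, δ₂₂, C₂₂, _Cα, hM22, hδ22, hC22, H22⟩ := h22
  obtain ⟨M₂₃, δ₂₃, C₂₃, hM23, hδ23, hC23, H23⟩ := h23
  obtain ⟨M₂₆, δ₃, C₂₆, Cα₂₆, Cε₂₆, Cαε₂₆, hM26, hδ3, hC26, H26⟩ := h26
  obtain ⟨Ma, Ba, δa, Bβa, Bεa, Bεβa, hMa, hBa, hδa, Ha⟩ := hGp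
  obtain ⟨Mb, Bb, hMb, hBb, Hb⟩ := hGA
  obtain ⟨M₁, hM₁pos, hM1, hM2, hM3, hM4, hM5⟩ :
      ∃ M₁ : ℝ, 0 < M₁ ∧ M₂₂ ≤ M₁ ∧ M₂₃ ≤ M₁ ∧ M₂₆ ≤ M₁ ∧ Ma ≤ M₁ ∧ Mb ≤ M₁ :=
    ⟨max (max (max M₂₂ M₂₃) (max M₂₆ Ma)) Mb, lt_of_lt_of_le hMb (le_max_right _ _),
      le_max_of_le_left (le_max_of_le_left (le_max_left _ _)),
      le_max_of_le_left (le_max_of_le_left (le_max_right _ _)),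
      le_max_of_le_left (le_max_of_le_right (le_max_left _ _)),
      le_max_of_le_left (le_max_of_le_right (le_max_right _ _)), le_max_right _ _⟩
  obtain ⟨B₀, hB₀pos, hB1, hB2, hB3, hB4⟩ :
      ∃ B₀ : ℝ, 0 < B₀ ∧ C₂₂ ≤ B₀ ∧ C₂₆ ≤ B₀ ∧ Ba ≤ B₀ ∧ Bb ≤ B₀ :=
    ⟨max (max C₂₂ C₂₆) (max Ba Bb), lt_of_lt_of_le hC22 (le_max_of_le_left (le_max_left _ _)),
      le_max_of_le_left (le_max_left _ _), le_max_of_le_left (le_max_right _ _),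
      le_max_of_le_right (le_max_left _ _), le_max_of_le_right (le_max_right _ _)⟩
  have hB₀nn : 0 ≤ B₀ := hB₀pos.le
  obtain ⟨δ₀, hδ₀pos, hδ1, hδ2, hδ3'⟩ : ∃ δ₀ : ℝ, 0 < δ₀ ∧ δ₀ ≤ δ₂₂ / 2 ∧ δ₀ ≤ δ₃ ∧ δ₀ ≤ δa :=
    ⟨min (min (δ₂₂ / 2) δ₃) δa, lt_min (lt_min (half_pos hδ22) hδ3) hδa,
      (min_le_left _ _).trans (min_le_left _ _), (min_le_left _ _).trans (min_le_right _ _),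
      min_le_right _ _⟩
  obtain ⟨Bβ, hBβ⟩ : ∃ Bβ : ℝ → ℝ, ∀ β, 0 ≤ Bβ β ∧ Bβa β ≤ Bβ β ∧ Cα₂₆ β ≤ Bβ β :=
    ⟨fun β => max (max (Bβa β) (Cα₂₆ β)) 0, fun β =>
      ⟨le_max_right _ _, le_max_of_le_left (le_max_left _ _), le_max_of_le_left (le_max_right _ _)⟩⟩
  obtain ⟨Bε, hBε⟩ : ∃ Bε : ℝ → ℝ, ∀ ε, 0 ≤ Bε ε ∧ Bεa ε ≤ Bε ε ∧ Cε₂₆ (ε / 2) ≤ Bε ε :=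
    ⟨fun ε => max (max (Bεa ε) (Cε₂₆ (ε / 2))) 0, fun ε =>
      ⟨le_max_right _ _, le_max_of_le_left (le_max_left _ _), le_max_of_le_left (le_max_right _ _)⟩⟩
  obtain ⟨Bεβ, hBεβ⟩ : ∃ Bεβ : ℝ → ℝ → ℝ, ∀ ε β, 0 ≤ Bεβ ε β ∧ Bεβa ε β ≤ Bεβ ε β ∧
      Cαε₂₆ β (min ε ((1 - β) / 2)) ≤ Bεβ ε β :=
    ⟨fun ε β => max (max (Bεβa ε β) (Cαε₂₆ β (min ε ((1 - β) / 2)))) 0, fun ε β =>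
      ⟨le_max_right _ _, le_max_of_le_left (le_max_left _ _), le_max_of_le_left (le_max_right _ _)⟩⟩
  refine ⟨M₁, B₀, δ₀, Bβ, Bε, Bεβ, C₂₃, δ₂₃ / 2, hM₁pos, hB₀pos, hδ₀pos, hC23, half_pos hδ23, ?_⟩
  intro i hM
  have hM₆ : M₁ ≤ (geo₆ i).M := by rw [(D i).M_eq]; exact hM
  obtain ⟨P22e, -⟩ := H22 i (D i).hyp (hM1.trans hM₆)
  have P23 := H23 i (D i).hyp (hM2.trans hM₆)
  obtain ⟨P26e, P26h1, P26e4, P26h2, P26l2⟩ := H26 i (D i).hyp (hM3.trans hM₆)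
  obtain ⟨PaL2, PaGlob, PaH1, PaE4, PaH2⟩ := Ha i (hM4.trans hM)
  have Pb := Hb i (hM5.trans hM)
  have Sg := S i
  have hlen : ∀ y : (geo i).Site, 0 ≤ (geo i).len y := fun y => Sg.len_nonneg y
  unfold B9.Thms31to33IneqAt B9.Ineq342_346_347 B9.Ineq343_345
  refine ⟨⟨⟨?_, ?_, ?_⟩, ⟨?_, ?_, ?_⟩⟩, ?_, ⟨⟨?_, ?_, ?_⟩, ⟨?_, ?_, ?_⟩⟩⟩
  · -- (3.42) for G′(1) ⇐ B6 (2.67)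
    intro n lam y y' hs
    have h6 := P22e n ((D i).loc lam) ((D i).site y) ((D i).site y') ((D i).supp lam y' hs)
    rw [(D i).len_eq, (D i).dist_eq, (D i).supNorm_eq, pref4_eq] at h6
    exact weaken4 (((D i).Gp_e n lam y).trans h6) hB1 hB₀nn (pref4_nonneg (hlen y) n)
      (Sg.supNorm_nonneg lam) hδ1 (Sg.dist_nonneg y y')
  · -- (3.46) for G′(1): residual
    intro n lam h y y' hh hs
    exact weaken5 (PaL2 n lam h y y' hh hs) hB3 hB₀nn (pref6_nonneg (hlen y) n) (Sg.cutSup_nonneg h)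
      (Sg.l2Norm_nonneg lam) hδ3' (Sg.dist_nonneg y y')
  · -- (3.47) for G′(1): residual
    intro n lam γ h1 h2
    exact (PaGlob n lam γ h1 h2).trans (mul_le_mul_of_nonneg_right hB3 (Sg.wNorm_nonneg γ lam))
  · -- (3.43) for G′(1): residual
    intro β lam ζ y y' hβ0 hβ1 hζ hs
    exact weaken5 (PaH1 β lam ζ y y' hβ0 hβ1 hζ hs) (hBβ β).2.1 (hBβ β).1 (Real.rpow_nonneg (hlen y) _)
      (Sg.cutH_nonneg β ζ) (Sg.supNorm_nonneg lam) hδ3' (Sg.dist_nonneg y y')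
  · -- (3.44) for G′(1): residual
    intro ε lam y y' hε0 hε1 hs
    exact weaken3 (PaE4 ε lam y y' hε0 hε1 hs) (hBε ε).2.1 (hBε ε).1
      (add_nonneg (Sg.holder_nonneg ε lam) (Sg.supNorm_nonneg lam)) hδ3' (Sg.dist_nonneg y y')
  · -- (3.45) for G′(1): residual
    intro ε β lam ζ y y' hε0 hε1 hβ0 hβ1 hζ hs
    exact weaken5 (PaH2 ε β lam ζ y y' hε0 hε1 hβ0 hβ1 hζ hs) (hBεβ ε β).2.1 (hBεβ ε β).1
      (Real.rpow_nonneg (hlen y) _) (Sg.cutH_nonneg β ζ)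
      (add_nonneg (Sg.holder_nonneg _ lam) (Sg.supNorm_nonneg lam)) hδ3' (Sg.dist_nonneg y y')
  · -- (3.48) at U = 1 ⇐ B6 (2.87)
    intro y y'
    have h6 := P23 ((D i).site y) ((D i).site y')
    rw [(D i).len_eq, (D i).len_eq, (D i).dist_eq] at h6
    exact ((D i).C_ker y y').trans h6
  · -- (3.42) for G(1) ⇐ B6 (2.136)
    intro n lam y y' hs
    have h6 := P26e n ((D i).loc lam) ((D i).site y) ((D i).site y') ((D i).supp lam y' hs)
    rw [(D i).len_eq, (D i).dist_eq, (D i).supNorm_eq, pref4_eq] at h6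
    exact weaken4 (((D i).GA_e n lam y).trans h6) hB2 hB₀nn (pref4_nonneg (hlen y) n)
      (Sg.supNorm_nonneg lam) hδ2 (Sg.dist_nonneg y y')
  · -- (3.46) for G(1) ⇐ B6 (2.140)
    intro n lam h y y' hh hs
    have h6 := P26l2 n ((D i).loc lam) ((D i).cut h) ((D i).site y) ((D i).site y')
      ((D i).cutIn h y hh) ((D i).supp lam y' hs)
    rw [(D i).len_eq, (D i).cutSup_eq, (D i).dist_eq, (D i).l2Norm_eq, pref6_eq] at h6
    exact weaken5 (((D i).GA_l2 n lam h).trans h6) hB2 hB₀nn (pref6_nonneg (hlen y) n)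
      (Sg.cutSup_nonneg h) (Sg.l2Norm_nonneg lam) hδ2 (Sg.dist_nonneg y y')
  · -- (3.47) for G(1): residual
    intro n lam γ h1 h2
    exact (Pb n lam γ h1 h2).trans (mul_le_mul_of_nonneg_right hB4 (Sg.wNorm_nonneg γ lam))
  · -- (3.43) for G(1) ⇐ B6 (2.137)
    intro β lam ζ y y' hβ0 hβ1 hζ hs
    have h6 := P26h1 β ((D i).loc lam) ((D i).cut ζ) ((D i).site y) ((D i).site y') hβ0 hβ1
      ((D i).cutT ζ y hζ) ((D i).supp lam y' hs)
    rw [(D i).len_eq, (D i).cutH_eq, (D i).dist_eq, (D i).supNorm_eq] at h6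
    exact weaken5 (((D i).GA_h1 lam β ζ).trans h6) (hBβ β).2.2 (hBβ β).1 (Real.rpow_nonneg (hlen y) _)
      (Sg.cutH_nonneg β ζ) (Sg.supNorm_nonneg lam) hδ2 (Sg.dist_nonneg y y')
  · -- (3.44) for G(1) ⇐ B6 (2.138) at ε′ = ε/2; ON `P i`: ‖λ‖_{ε/2} ≤ ‖λ‖_ε (G-B9-13); OFF `P i`: the quantity is ≤ 0 ≤ RHS
    intro ε lam y y' hε0 hε1 hs
    have hrhs : 0 ≤ Bε ε * Real.exp (-(δ₀ * (geo i).dist y y')) * ((geo i).holder ε lam + (geo i).supNorm lam) :=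
      mul_nonneg (mul_nonneg (hBε ε).1 (Real.exp_nonneg _)) (add_nonneg (Sg.holder_nonneg _ lam) (Sg.supNorm_nonneg lam))
    by_cases hP : P i lam
    · have hε' : 0 < ε / 2 := half_pos hε0
      have hε'1 : ε / 2 < 1 := by linarith
      have h6 := P26e4 (ε / 2) ((D i).loc lam) ((D i).site y) ((D i).site y') hε' hε'1
        ((D i).suppT lam y' hs)
      rw [(D i).dist_eq, (D i).holder_eq, (D i).supNorm_eq] at h6
      have h7 := weaken3 (((D i).GA_e4 lam y).trans h6) (hBε ε).2.2 (hBε ε).1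
        (add_nonneg (Sg.holder_nonneg _ lam) (Sg.supNorm_nonneg lam)) hδ2 (Sg.dist_nonneg y y')
      refine h7.trans (mul_le_mul_of_nonneg_left (add_le_add (Sg.holder_mono_on _ _ lam hP ?_) le_rfl)
        (mul_nonneg (hBε ε).1 (Real.exp_nonneg _)))
      linarith
    · exact (hE4 i lam hP y).trans hrhs
  · -- (3.45) for G(1) ⇐ B6 (2.139) at ε′ = min{ε, (1−β)/2}; ON `P i`: ‖λ‖_{β+ε′} ≤ ‖λ‖_{β+ε}; OFF `P i`: ≤ 0 ≤ RHS
    intro ε β lam ζ y y' hε0 hε1 hβ0 hβ1 hζ hs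
    have hrhs : 0 ≤ Bεβ ε β * (geo i).len y ^ (-β) * (geo i).cutH β ζ * Real.exp (-(δ₀ * (geo i).dist y y')) *
        ((geo i).holder (β + ε) lam + (geo i).supNorm lam) :=
      mul_nonneg (mul_nonneg (mul_nonneg (mul_nonneg (hBεβ ε β).1 (Real.rpow_nonneg (hlen y) _)) (Sg.cutH_nonneg β ζ))
        (Real.exp_nonneg _)) (add_nonneg (Sg.holder_nonneg _ lam) (Sg.supNorm_nonneg lam))
    by_cases hP : P i lam
    · have hε' : 0 < min ε ((1 - β) / 2) := lt_min hε0 (by linarith)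
      have hle : min ε ((1 - β) / 2) ≤ ε := min_le_left _ _
      have hsum : β + min ε ((1 - β) / 2) < 1 := by
        have := min_le_right ε ((1 - β) / 2); linarith
      have h6 := P26h2 β (min ε ((1 - β) / 2)) ((D i).loc lam) ((D i).cut ζ) ((D i).site y)
        ((D i).site y') hβ0 hε' hsum ((D i).cutT ζ y hζ) ((D i).suppT lam y' hs)
      rw [(D i).len_eq, (D i).cutH_eq, (D i).dist_eq, (D i).holder_eq, (D i).supNorm_eq] at h6
      have h7 := weaken5 (((D i).GA_h2 lam β ζ).trans h6) (hBεβ ε β).2.2 (hBεβ ε β).1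
        (Real.rpow_nonneg (hlen y) _) (Sg.cutH_nonneg β ζ)
        (add_nonneg (Sg.holder_nonneg _ lam) (Sg.supNorm_nonneg lam)) hδ2 (Sg.dist_nonneg y y')
      refine h7.trans (mul_le_mul_of_nonneg_left (add_le_add (Sg.holder_mono_on _ _ lam hP ?_) le_rfl)
        (mul_nonneg (mul_nonneg (mul_nonneg (hBεβ ε β).1 (Real.rpow_nonneg (hlen y) _))
          (Sg.cutH_nonneg β ζ)) (Real.exp_nonneg _)))
      linarith
    · exact (hH2 i lam hP β ζ).trans hrhs

/-- **Corollary 3.5 from [4] + Sect. B with the restricted sign schema** (`B9FromB6.cor35_of_B6` re-run: the base above composed with b09's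
`B9.cor35_of_sectB_base`). [cite: Balaban1985BackgroundPropagators, Cor. 3.5 p.407] -/
theorem cor35_of_B6_on {I : Type} (d : ℕ) (c35 : ℝ) (geo₆ : I → B6.Geometry)
    (Gp₆ : ∀ i, B6.GpFamily (geo₆ i)) (C₆ : ∀ i, B6.SiteKernel (geo₆ i)) (G₆ : ∀ i, B6.GFamily (geo₆ i))
    (geo : I → B9.Geometry) (bg : I → B9.Backgrounds) (Gp GA : ∀ i, B9.KernelFamily (geo i) (bg i))
    (C : ∀ i, B9.SiteKernel (geo i) (bg i))
    (IsAnalyticExt : ∀ i, B9.KernelFamily (geo i) (bg i) → (bg i).Cfg → ℝ → Prop)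
    (D : ∀ i, DictAtOne (geo₆ i) (geo i) (bg i) (Gp₆ i) (C₆ i) (G₆ i) (Gp i) (GA i) (C i))
    (P : ∀ i, (geo i).Loc → Prop) (S : ∀ i, ModelSignsOn (geo i) (P i))
    (hE4 : ∀ i (lam : (geo i).Loc), ¬ P i lam → ∀ y, (GA i).e4 (bg i).one lam y ≤ 0)
    (hH2 : ∀ i (lam : (geo i).Loc), ¬ P i lam → ∀ (β : ℝ) (ζ : (geo i).Cut), (GA i).h2 (bg i).one lam β ζ ≤ 0)
    (h22 : B6.Prop22Printed geo₆ Gp₆) (h23 : B6.Prop23Printed d geo₆ C₆) (h26 : B6.Prop26Printed geo₆ G₆)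
    (hGp : ResidualGpAtOne geo bg Gp) (hGA : ResidualGAGlobAtOne geo bg GA)
    (hone : ∀ (i : I) (α₀ : ℝ), 0 < α₀ → (bg i).Reg335 c35 α₀ (bg i).one)
    (hB : B9.SectBStepPrinted d c35 geo bg Gp GA C IsAnalyticExt) :
    B9.Cor35Printed d geo bg Gp GA C :=
  B9.cor35_of_sectB_base d c35 geo bg Gp GA C IsAnalyticExt hone
    (baseU1_of_B6_on d geo₆ Gp₆ C₆ G₆ geo bg Gp GA C D P S hE4 hH2 h22 h23 h26 hGp hGA) hB

end Literature.MathematicalPhysics.QuantumFieldTheory.Balaban1983to89.B9FromB6ModelSignsOn
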